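import Summits.AtomisticToContinuum.Crystallization.Theorems.PhononSlackCertificatesPeriodicGivenLayeredClosing6
import Summits.AtomisticToContinuum.Crystallization.Theorems.PhononSlackCertificatesPeriodicGivenLayeredWindowBounds
import Summits.AtomisticToContinuum.Crystallization.Theorems.PhononSlackCertificatesPeriodicGivenLayeredConvexity
import Summits.AtomisticToContinuum.Crystallization.Theorems.PhononSlackCertificatesPeriodicGivenLayeredLayerCake

/-!
# `stub_uniformSpacingSelection` (crux `GapTwelveToBarlow`, stmt-AtomisticToContinuum-15807), energetic side, II:
# BLOCK-LOCAL Part B — squared variation of the increments on fault-free blocks of the hull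

Helper for the energetic residual `stub_uniformSpacingSelection` of `stub_uniformSpacing` (a.e.
near-uniform interlayer gaps of relaxed-layered windows of Lennard-Jones ground states; see
`UniformSpacingHullFaults` for part I, the hull fault bound).  `LayeredHull.clo_partB` (stmt-11779, line
`Sketch` of `PeriodicGivenLayered`, landed) shows that a GLOBALLY fault-free UNIFORMLY RECURRENT layered
set in the hull of a ground-state sequence has constant increments.  Its energy comparison is in fact
local and quantitative; two things must be localised.

1. The block decomposition `LayeredHull.clo_block_decomposition` (part 5 of `stub_closing`) is stated for
   a globally fault-free word, but its proof only uses the alternation of `s` INSIDE the block: the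
   alignment of layers `m₁ + i`, `m₁ + j` (`i < j ≤ n`) is decided by the window
   `s (m₁+i) + ⋯ + s (m₁+j-1)`, and the interaction of the block with the outside
   (`LayeredHull.clo_tail_one`) needs no word hypothesis.  We re-prove the chain `clo_faultfree_add →
   clo_haggWindow_faultfree → clo_haggAligned_faultfree_iff → clo_layerInteraction_faultfree →
   clo_pairs_eq_two_mul_block → clo_block_decomposition` under the LOCAL hypothesis
   `∀ l, l + 1 < n → s (m₁ + l + 1) = -s (m₁ + l)` (the interior layers of `[m₁, m₁ + n]` are
   hexagonal): `sel_block_decomposition`, `|Σ_{m ∈ [m₁, m₁+n]} T(m) − 2 F_n(Δ)| ≤ 16 C`.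
2. The three-prism comparison of `clo_partB` — prisms of `n + 1` layers and `K = n + 1` columns at `m₁`
   and at `m₁ + 1` of the given set `S` (hull upper bound (U) of `LayeredHull.stub_windowBounds`) against
   the prism at `m₁` of the layered set with the AVERAGED heights `(z m + z (m+1))/2` (same word, free
   lower bound (L)), equal cardinalities so that `2 E((n+1)K²)` cancels, the layer cake
   `LayeredHull.stub_layerCake` and the increment convexity `LayeredHull.stub_convexity` — then gives,
   WITHOUT recurrence, for every block `[m₁, m₁ + n + 1]` whose `n` interior layers are hexagonal,

   `Σ_{i < n} (Δ (m₁+i) − Δ (m₁+i+1))² ≤ O₀ := (4|C_U| + 4|C_L| + 64)·C / (2κ)`,  `Δ m = z (m+1) − z m`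

   (`hull_sqVariation_le_of_landed`, anchor `stub_hullSqVariation`), `O₀` depending only on the universal
   constants of stubs 3, 5, 6 of stmt-11779.

With the hull fault bound (`≤ F₀` faults per block, part I) this bounds the number of base layers of any
block around which the heights are not `δ`-close to arithmetic (part III, `UniformSpacingSelectionCount`).
-/

noncomputable section

namespace Summit.AtomisticToContinuum.Crystallization.Theorems.SquareWellLayerCakeGapTwelveToBarlow

open scoped BigOperators
open Finset Filter Literature.MathematicalPhysics.StatisticalMechanics
open Summit.AtomisticToContinuum.Crystallization.Theorems.LayeredHull

variable {s : ℤ → ℤ}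

/-! ## Locally fault-free words -/

/-- Local alternation: if `s (m + l + 1) = -s (m + l)` for `l < k` then `s (m + k) = ± s m` according to
the parity of `k` (local form of `LayeredHull.clo_faultfree_add`). [folklore] -/
theorem sel_faultfree_add (m : ℤ) (k : ℕ) (h : ∀ l : ℕ, l < k → s (m + l + 1) = -s (m + l)) :
    s (m + k) = if Even k then s m else -s m := by
  induction k with
  | zero => simp
  | succ k ih =>
    have ih' := ih fun l hl => h l (Nat.lt_succ_of_lt hl)
    have hk := h k (Nat.lt_succ_self k)
    push_cast
    rw [← add_assoc, hk, ih']
    by_cases he : Even k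
    · rw [if_pos he, if_neg (Nat.even_add_one.not.2 (not_not.2 he))]
    · rw [if_neg he, if_pos (Nat.even_add_one.2 he), neg_neg]

/-- Windows of a locally fault-free word: `0` over an even length, `s m` over an odd one; only the
alternation at `m, …, m + k - 2` is used (local form of `LayeredHull.clo_haggWindow_faultfree`).
[folklore] -/
theorem sel_haggWindow_faultfree (m : ℤ) (k : ℕ) (h : ∀ l : ℕ, l + 1 < k → s (m + l + 1) = -s (m + l)) :
    haggWindow s m k = if Even k then 0 else s m := by
  induction k with
  | zero => simp
  | succ k ih =>
    have ih' := ih fun l hl => h l (by omega)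
    rw [haggWindow_succ, ih', sel_faultfree_add m k fun l hl => h l (by omega)]
    by_cases hk : Even k
    · rw [if_pos hk, if_pos hk, if_neg (Nat.even_add_one.not.2 (not_not.2 hk)), zero_add]
    · rw [if_neg hk, if_neg hk, if_pos (Nat.even_add_one.2 hk), add_neg_cancel]

/-- For a locally fault-free Hägg word, layers `m` and `m + k` are aligned iff `k` is even (local form of
`LayeredHull.clo_haggAligned_faultfree_iff`). [folklore] -/
theorem sel_haggAligned_faultfree_iff (hs : IsHaggSeq s) (m : ℤ) (k : ℕ)
    (h : ∀ l : ℕ, l + 1 < k → s (m + l + 1) = -s (m + l)) : HaggAligned s m k ↔ Even k := by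
  change haggWindow s m k % 3 = 0 ↔ _
  rw [sel_haggWindow_faultfree m k h]
  by_cases hk : Even k
  · simp [hk]
  · simp only [hk, if_false, iff_false]
    rcases hs m with h1 | h1 <;> rw [h1] <;> decide

/-- **Registry of a locally fault-free stacking**: a site of layer `m` sees layer `m + k` aligned iff `k`
is even (local form of `LayeredHull.clo_layerInteraction_faultfree`). [folklore] -/
theorem sel_layerInteraction_faultfree (hs : IsHaggSeq s) (V : ℝ → ℝ) (a H : ℝ) (m : ℤ) (k : ℕ)
    (h : ∀ l : ℕ, l + 1 < k → s (m + l + 1) = -s (m + l)) :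
    layerInteraction V a H (haggLabel s (m + k) - haggLabel s m) 1 =
      layerInteraction V a H (if Even k then 0 else 1) 1 := by
  rw [clo_layerInteraction_label_add]
  by_cases hk : Even k
  · rw [if_pos ((sel_haggAligned_faultfree_iff hs m k h).2 hk), if_pos hk]
    unfold barlowCoupling
    simp only [Nat.cast_one]
    ring
  · rw [if_neg (fun h' => hk ((sel_haggAligned_faultfree_iff hs m k h).1 h')), if_neg hk, add_zero]

/-! ## Pair interactions inside a locally fault-free block -/

/-- **In-block pair interactions of a locally fault-free stacking.** Over the `n + 1` layers
`m₁, …, m₁+n` whose `n - 1` interior layers are hexagonal (`s (m₁+l+1) = -s (m₁+l)` for `l + 1 < n`), the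
sum over ordered pairs of distinct layers of the pair interaction equals twice the alternating block
energy `F_n(Δ)` of `LayeredHull.stub_convexity` in the increments `Δ l = z (m₁+l+1) − z (m₁+l)` (local
form of `LayeredHull.clo_pairs_eq_two_mul_block`). [folklore] -/
theorem sel_pairs_eq_two_mul_block (hs : IsHaggSeq s) (a : ℝ) (z : ℤ → ℝ) (m₁ : ℤ) (n : ℕ)
    (hff : ∀ l : ℕ, l + 1 < n → s (m₁ + l + 1) = -s (m₁ + l)) :
    ∑ i ∈ Finset.range (n + 1), ∑ j ∈ Finset.range (n + 1),
        (if m₁ + (j : ℤ) = m₁ + (i : ℤ) then (0 : ℝ) else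
          layerInteraction lennardJones a (z (m₁ + j) - z (m₁ + i))
            (haggLabel s (m₁ + j) - haggLabel s (m₁ + i)) 1) =
      2 * ∑ i ∈ Finset.range n, ∑ j ∈ Finset.Ioc i n, layerInteraction lennardJones a
        (∑ l ∈ Finset.Ico i j, (z (m₁ + l + 1) - z (m₁ + l))) (if Even (j - i) then 0 else 1) 1 := by
  -- the pair function and its symmetry
  set g : ℕ → ℕ → ℝ := fun i j => layerInteraction lennardJones a (z (m₁ + j) - z (m₁ + i))
    (haggLabel s (m₁ + j) - haggLabel s (m₁ + i)) 1 with hg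
  have hsymm : ∀ i j, g j i = g i j := fun i j => by
    simp only [hg]
    rw [← clo_layerInteraction_symm, neg_sub, neg_sub]
  -- ordered pairs = (i < j) + (j < i), and the second equals the first by symmetry
  have hsplit : ∀ i ∈ Finset.range (n + 1),
      (∑ j ∈ Finset.range (n + 1), if m₁ + (j : ℤ) = m₁ + (i : ℤ) then (0 : ℝ) else g i j) =
        (∑ j ∈ Finset.range (n + 1), if i < j then g i j else 0) +
          ∑ j ∈ Finset.range (n + 1), if j < i then g i j else 0 := by
    intro i _
    rw [← Finset.sum_add_distrib]
    refine Finset.sum_congr rfl fun j _ => ?_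
    rcases lt_trichotomy i j with hij | rfl | hij
    · rw [if_neg (by omega), if_pos hij, if_neg (lt_asymm hij), add_zero]
    · simp
    · rw [if_neg (by omega), if_neg (lt_asymm hij), if_pos hij, zero_add]
  have hupper : ∀ i ∈ Finset.range (n + 1),
      (∑ j ∈ Finset.range (n + 1), if i < j then g i j else 0) = ∑ j ∈ Finset.Ioc i n, g i j := by
    intro i _
    rw [← Finset.sum_filter]
    congr 1
    ext j
    simp only [Finset.mem_filter, Finset.mem_range, Finset.mem_Ioc]
    omega
  have hlower : (∑ i ∈ Finset.range (n + 1), ∑ j ∈ Finset.range (n + 1), if j < i then g i j else 0) =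
      ∑ i ∈ Finset.range (n + 1), ∑ j ∈ Finset.range (n + 1), if i < j then g i j else 0 := by
    rw [Finset.sum_comm]
    refine Finset.sum_congr rfl fun i _ => Finset.sum_congr rfl fun j _ => ?_
    by_cases hij : i < j
    · rw [if_pos hij, if_pos hij, hsymm]
    · rw [if_neg hij, if_neg hij]
  have hlast : (∑ i ∈ Finset.range (n + 1), ∑ j ∈ Finset.Ioc i n, g i j) =
      ∑ i ∈ Finset.range n, ∑ j ∈ Finset.Ioc i n, g i j := by
    rw [Finset.sum_range_succ, Finset.Ioc_self, Finset.sum_empty, add_zero]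
  -- identify the pair interaction for `i < j ≤ n`: only the alternation at `m₁ + i, …, m₁ + j - 2` is used
  have hpair : ∀ i ∈ Finset.range n, ∀ j ∈ Finset.Ioc i n, g i j = layerInteraction lennardJones a
      (∑ l ∈ Finset.Ico i j, (z (m₁ + l + 1) - z (m₁ + l))) (if Even (j - i) then 0 else 1) 1 := by
    intro i _ j hj
    have hij : i < j := (Finset.mem_Ioc.1 hj).1
    have hjn : j ≤ n := (Finset.mem_Ioc.1 hj).2
    simp only [hg]
    rw [← clo_height_telescope z m₁ hij.le]
    have e : m₁ + (j : ℤ) = m₁ + (i : ℤ) + ((j - i : ℕ) : ℤ) := by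
      rw [Nat.cast_sub hij.le]; ring
    have hloc : ∀ l : ℕ, l + 1 < j - i → s (m₁ + (i : ℤ) + l + 1) = -s (m₁ + (i : ℤ) + l) := by
      intro l hl
      have h' := hff (i + l) (by omega)
      have e' : m₁ + (i : ℤ) + (l : ℤ) = m₁ + ((i + l : ℕ) : ℤ) := by push_cast; ring
      rw [e']
      exact h'
    rw [e, sel_layerInteraction_faultfree hs _ _ _ (m₁ + i) (j - i) hloc, ← e]
  -- assemble
  calc (∑ i ∈ Finset.range (n + 1), ∑ j ∈ Finset.range (n + 1),
        (if m₁ + (j : ℤ) = m₁ + (i : ℤ) then (0 : ℝ) else g i j))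
      = (∑ i ∈ Finset.range (n + 1), ∑ j ∈ Finset.range (n + 1), if i < j then g i j else 0) +
          ∑ i ∈ Finset.range (n + 1), ∑ j ∈ Finset.range (n + 1), if j < i then g i j else 0 := by
        rw [← Finset.sum_add_distrib]; exact Finset.sum_congr rfl hsplit
    _ = 2 * ∑ i ∈ Finset.range (n + 1), ∑ j ∈ Finset.Ioc i n, g i j := by
        rw [hlower, Finset.sum_congr rfl hupper]; ring
    _ = 2 * ∑ i ∈ Finset.range n, ∑ j ∈ Finset.Ioc i n, g i j := by rw [hlast]
    _ = _ := by
        congr 1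
        exact Finset.sum_congr rfl fun i hi => Finset.sum_congr rfl fun j hj => hpair i hi j hj

/-! ## The block-local block decomposition -/

/-- **Block-local block decomposition.** For a Hägg word whose layers `m₁ + 1, …, m₁ + n - 1` are
hexagonal (`s (m₁+l+1) = -s (m₁+l)` for `l + 1 < n`; nothing is assumed outside the block) and admissible
heights, the registry energies of the `n + 1` layers `m₁, …, m₁+n` sum to twice the alternating block
energy of `LayeredHull.stub_convexity` in the increments `Δ l = z (m₁+l+1) − z (m₁+l)`, up to a
boundary-layer term `≤ 16 C` in absolute value (local form of `LayeredHull.clo_block_decomposition`; the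
tail estimate `LayeredHull.clo_tail_one` is word-independent). [folklore] -/
theorem sel_block_decomposition {a : ℝ} (ha : 47 / 50 ≤ a) (hs : IsHaggSeq s) {z : ℤ → ℝ}
    (hz : ∀ m : ℤ, 39 / 50 * a ≤ z (m + 1) - z m ∧ z (m + 1) - z m ≤ 17 / 20 * a) {C : ℝ}
    (hdecay : ∀ (H : ℝ) (δ : ℤ), 7 / 10 ≤ |H| → |layerInteraction lennardJones a H δ 1| ≤ C / H ^ 4)
    (hsum : ∀ m : ℤ, Summable fun m' : ℤ => if m' = m then (0 : ℝ) else
      layerInteraction lennardJones a (z m' - z m) (haggLabel s m' - haggLabel s m) 1)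
    (m₁ : ℤ) (n : ℕ) (hff : ∀ l : ℕ, l + 1 < n → s (m₁ + l + 1) = -s (m₁ + l)) :
    |(∑ m ∈ Finset.Ico m₁ (m₁ + ((n + 1 : ℕ) : ℤ)), (∑' m' : ℤ, if m' = m then (0 : ℝ) else
          layerInteraction lennardJones a (z m' - z m) (haggLabel s m' - haggLabel s m) 1)) -
      2 * ∑ i ∈ Finset.range n, ∑ j ∈ Finset.Ioc i n, layerInteraction lennardJones a
        (∑ l ∈ Finset.Ico i j, (z (m₁ + l + 1) - z (m₁ + l))) (if Even (j - i) then 0 else 1) 1| ≤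
      16 * C := by
  classical
  have hC : 0 ≤ C := by
    have h1 := hdecay 1 0 (by norm_num)
    have : (0 : ℝ) ≤ C / 1 ^ 4 := (abs_nonneg _).trans h1
    simpa using this
  -- reindex the block by `i < n + 1` and split every layer energy
  rw [clo_sum_Ico_eq_sum_range, ← sel_pairs_eq_two_mul_block hs a z m₁ n hff]
  have hlayer : ∀ i ∈ Finset.range (n + 1),
      (∑' m' : ℤ, if m' = m₁ + (i : ℤ) then (0 : ℝ) else
        layerInteraction lennardJones a (z m' - z (m₁ + i)) (haggLabel s m' - haggLabel s (m₁ + i)) 1) =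
      (∑ j ∈ Finset.range (n + 1), if m₁ + (j : ℤ) = m₁ + (i : ℤ) then (0 : ℝ) else
        layerInteraction lennardJones a (z (m₁ + j) - z (m₁ + i))
          (haggLabel s (m₁ + j) - haggLabel s (m₁ + i)) 1) +
      ∑' m' : ℤ, (if m' ∈ Finset.Ico m₁ (m₁ + ((n + 1 : ℕ) : ℤ)) then (0 : ℝ) else
        (if m' = m₁ + (i : ℤ) then (0 : ℝ) else
          layerInteraction lennardJones a (z m' - z (m₁ + i)) (haggLabel s m' - haggLabel s (m₁ + i)) 1)) := by
    intro i _
    rw [clo_layer_split a s z (Finset.Ico m₁ (m₁ + ((n + 1 : ℕ) : ℤ))) (m₁ + i) (hsum _),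
      clo_sum_Ico_eq_sum_range]
  rw [Finset.sum_congr rfl hlayer, Finset.sum_add_distrib, add_sub_cancel_left]
  -- the tails
  refine (Finset.abs_sum_le_sum_abs _ _).trans ?_
  have htail : ∀ i ∈ Finset.range (n + 1),
      |∑' m' : ℤ, (if m' ∈ Finset.Ico m₁ (m₁ + ((n + 1 : ℕ) : ℤ)) then (0 : ℝ) else
        (if m' = m₁ + (i : ℤ) then (0 : ℝ) else
          layerInteraction lennardJones a (z m' - z (m₁ + i)) (haggLabel s m' - haggLabel s (m₁ + i)) 1))| ≤
      4 / 3 * (4 * C) * ((((n + 1 - i : ℕ) : ℝ))⁻¹ ^ 3 + (((i + 1 : ℕ) : ℝ))⁻¹ ^ 3) :=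
    fun i hi => clo_tail_one ha s hz hdecay m₁ n i (Nat.lt_succ_iff.1 (Finset.mem_range.1 hi))
  refine (Finset.sum_le_sum htail).trans ?_
  rw [← Finset.mul_sum, Finset.sum_add_distrib]
  have h1 : ∑ i ∈ Finset.range (n + 1), (((i + 1 : ℕ) : ℝ))⁻¹ ^ 3 ≤ 3 / 2 := by
    have := clo_sum_inv_cube_le (n + 1)
    refine le_trans (le_of_eq (Finset.sum_congr rfl fun i _ => by push_cast; ring)) this
  have h2 : ∑ i ∈ Finset.range (n + 1), (((n + 1 - i : ℕ) : ℝ))⁻¹ ^ 3 ≤ 3 / 2 := by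
    rw [← Finset.sum_range_reflect (fun i => (((i + 1 : ℕ) : ℝ))⁻¹ ^ 3) (n + 1)] at h1
    refine le_trans (le_of_eq (Finset.sum_congr rfl fun i hi => ?_)) h1
    have hi' : i < n + 1 := Finset.mem_range.1 hi
    exact congr_arg (fun k : ℕ => ((k : ℝ))⁻¹ ^ 3) (by omega)
  nlinarith

/-! ## Block-local Part B -/

/-- **Block-local Part B (squared variation of the increments), discharged by the landed stubs of
stmt-11779.**  There is a universal `O₀` such that for every sequence `x` of Lennard-Jones ground states,
every layered set `A(S(a, s, z))` in the hull of `x` (`a ∈ [47/50, 1]`, `IsHaggSeq s`, increments in the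
box) and every block of layers `m₁, …, m₁ + n + 1` whose interior layers are hexagonal
(`s (m₁ + l + 1) = -s (m₁ + l)` for `l < n`; nothing is assumed outside the block), the squared variation
of the `n + 1` increments of the block is at most `O₀`.  No recurrence hypothesis. [folklore] -/
theorem hull_sqVariation_le_of_landed :
    ∃ O₀ : ℝ, ∀ (x : (N : ℕ) → (Fin N → (EuclideanSpace ℝ (Fin 3)))), (∀ N, IsGroundState lennardJones (x N)) →
      ∀ (a : ℝ), 47 / 50 ≤ a → a ≤ 1 →
      ∀ (A : (EuclideanSpace ℝ (Fin 3)) →ₗᵢ[ℝ] (EuclideanSpace ℝ (Fin 3))) (s : ℤ → ℤ) (z : ℤ → ℝ),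
      IsHaggSeq s → (∀ m : ℤ, 39 / 50 * a ≤ z (m + 1) - z m ∧ z (m + 1) - z m ≤ 17 / 20 * a) →
      (let S : Set (EuclideanSpace ℝ (Fin 3)) := {p | ∃ m i j : ℤ, p = A (((i : ℝ) • triangularVec₁ a) +
          ((j : ℝ) • triangularVec₂ a) + ((haggLabel s m : ℝ) • barlowOffset a) + (z m • layerNormal 1))};
        ∀ R ε : ℝ, 0 < ε → ∃ᶠ N in atTop, ∃ t : (EuclideanSpace ℝ (Fin 3)),
          (∀ p ∈ S, ‖p‖ ≤ R → ∃ i : Fin N, dist (x N i + t) p ≤ ε) ∧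
          (∀ i : Fin N, ‖x N i + t‖ ≤ R → ∃ p ∈ S, dist (x N i + t) p ≤ ε)) →
      ∀ (m₁ : ℤ) (n : ℕ), (∀ l : ℕ, l < n → s (m₁ + l + 1) = -s (m₁ + l)) →
        ∑ i ∈ Finset.range n,
          ((z (m₁ + i + 1) - z (m₁ + i)) - (z (m₁ + i + 2) - z (m₁ + i + 1))) ^ 2 ≤ O₀ := by
  classical
  -- the universal constants of stubs 3, 5, 6 of stmt-11779
  obtain ⟨CU, hU'⟩ := stub_windowBounds.1
  obtain ⟨CL, hL'⟩ := stub_windowBounds.2 (1 / 2) (by norm_num)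
  obtain ⟨κ, hκ, hconv'⟩ := stub_convexity
  obtain ⟨Cc, hcake'⟩ := stub_layerCake
  refine ⟨(4 * |CU| + 4 * |CL| + 64) * Cc / (2 * κ), ?_⟩
  intro x hx a ha ha1 A s z hs hz hH m₁ n hff
  have hconvA := hconv' a ha ha1
  obtain ⟨hdecay, hcakeA⟩ := hcake' a ha ha1
  obtain ⟨-, hsumS, -, hprismS⟩ := hcakeA A s z hs hz
  have hCc : 0 ≤ Cc := by
    have h1 := hdecay 1 0 (by norm_num)
    have : (0 : ℝ) ≤ Cc / 1 ^ 4 := (abs_nonneg _).trans h1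
    simpa using this
  -- the averaged heights (same word, increments in the box)
  have hzh : ∀ m : ℤ, 39 / 50 * a ≤ (z (m + 1) + z (m + 1 + 1)) / 2 - (z m + z (m + 1)) / 2 ∧
      (z (m + 1) + z (m + 1 + 1)) / 2 - (z m + z (m + 1)) / 2 ≤ 17 / 20 * a := by
    intro m
    have h1 := hz m
    have h2 := hz (m + 1)
    constructor <;> linarith [h1.1, h1.2, h2.1, h2.2]
  obtain ⟨hsepH, hsumH, -, hprismH⟩ := hcakeA A s (fun m => (z m + z (m + 1)) / 2) hs hzh
  -- the three prisms: `n + 1` layers from `m₁` and from `m₁ + 1` of `S`, from `m₁` of the averaged set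
  obtain ⟨hW1sub, hW1card, hW1sum, hW1bd⟩ := hprismS m₁ (n + 1) (n + 1)
  obtain ⟨hW2sub, hW2card, hW2sum, hW2bd⟩ := hprismS (m₁ + 1) (n + 1) (n + 1)
  obtain ⟨hWhsub, hWhcard, hWhsum, hWhbd⟩ := hprismH m₁ (n + 1) (n + 1)
  have hU1 := hU' x hx _ hH _ hW1sub
  have hU2 := hU' x hx _ hH _ hW2sub
  have hLh := hL' _ hsepH _ hWhsub
  rw [hW1card, hW1sum] at hU1
  rw [hW2card, hW2sum] at hU2
  rw [hWhcard, hWhsum] at hLh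
  have hU1' := clo_absorb_upper hU1 hW1bd (Finset.sum_nonneg fun p _ =>
    pow_nonneg (inv_nonneg.2 (add_nonneg zero_le_one Metric.infDist_nonneg)) 3)
  have hU2' := clo_absorb_upper hU2 hW2bd (Finset.sum_nonneg fun p _ =>
    pow_nonneg (inv_nonneg.2 (add_nonneg zero_le_one Metric.infDist_nonneg)) 3)
  have hLh' := clo_absorb_lower hLh hWhbd (Finset.sum_nonneg fun p _ =>
    pow_nonneg (inv_nonneg.2 (add_nonneg zero_le_one Metric.infDist_nonneg)) 3)
  clear hU1 hU2 hLh hW1bd hW2bd hWhbd hW1sub hW2sub hWhsub hW1card hW2card hWhcard hW1sum hW2sum hWhsum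
  rw [clo_sum_const_add] at hU1' hU2' hLh'
  -- the block-local block decompositions (interior layers of `[m₁, m₁+n]`, `[m₁+1, m₁+n+1]` hexagonal)
  have hB1 := sel_block_decomposition ha hs hz hdecay hsumS m₁ n fun l hl => hff l (by omega)
  have hB2 := sel_block_decomposition ha hs hz hdecay hsumS (m₁ + 1) n fun l hl => by
    have h' := hff (l + 1) (by omega)
    have e' : m₁ + 1 + (l : ℤ) = m₁ + ((l + 1 : ℕ) : ℤ) := by push_cast; ring
    rw [e']
    exact h'
  have hBh := sel_block_decomposition (z := fun m => (z m + z (m + 1)) / 2) ha hs hzh hdecay hsumH m₁ n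
    fun l hl => hff l (by omega)
  rw [abs_le] at hB1 hB2 hBh
  -- increment convexity for `Δ` and its shift
  have hcv := hconvA n (fun l : ℕ => z (m₁ + (l : ℤ) + 1) - z (m₁ + (l : ℤ)))
    (fun l : ℕ => z (m₁ + 1 + (l : ℤ) + 1) - z (m₁ + 1 + (l : ℤ)))
    (fun i _ => hz (m₁ + (i : ℤ))) (fun i _ => hz (m₁ + 1 + (i : ℤ)))
  -- the midpoint block energy is the block energy of the averaged heights
  have hmid : (∑ i ∈ Finset.range n, ∑ j ∈ Finset.Ioc i n, layerInteraction lennardJones a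
      (∑ l ∈ Finset.Ico i j, ((z (m₁ + (l : ℤ) + 1) - z (m₁ + (l : ℤ))) +
        (z (m₁ + 1 + (l : ℤ) + 1) - z (m₁ + 1 + (l : ℤ)))) / 2) (if Even (j - i) then 0 else 1) 1) =
      (∑ i ∈ Finset.range n, ∑ j ∈ Finset.Ioc i n, layerInteraction lennardJones a
        (∑ l ∈ Finset.Ico i j, ((z (m₁ + (l : ℤ) + 1) + z (m₁ + (l : ℤ) + 1 + 1)) / 2 -
          (z (m₁ + (l : ℤ)) + z (m₁ + (l : ℤ) + 1)) / 2)) (if Even (j - i) then 0 else 1) 1) := by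
    refine Finset.sum_congr rfl fun i _ => Finset.sum_congr rfl fun j _ => ?_
    congr 1
    refine Finset.sum_congr rfl fun l _ => ?_
    have e1 : z (m₁ + 1 + (l : ℤ) + 1) = z (m₁ + (l : ℤ) + 1 + 1) := congr_arg z (by ring)
    have e2 : z (m₁ + 1 + (l : ℤ)) = z (m₁ + (l : ℤ) + 1) := congr_arg z (by ring)
    rw [e1, e2]
    ring
  rw [hmid] at hcv
  -- the squared variation in the shifted form
  have hQ : ∑ i ∈ Finset.range n,
      ((z (m₁ + i + 1) - z (m₁ + i)) - (z (m₁ + i + 2) - z (m₁ + i + 1))) ^ 2 =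
      ∑ i ∈ Finset.range n, ((z (m₁ + (i : ℤ) + 1) - z (m₁ + (i : ℤ))) -
        (z (m₁ + 1 + (i : ℤ) + 1) - z (m₁ + 1 + (i : ℤ)))) ^ 2 := by
    refine Finset.sum_congr rfl fun i _ => ?_
    have e1 : z (m₁ + 1 + (i : ℤ) + 1) = z (m₁ + (i : ℤ) + 2) := congr_arg z (by ring)
    have e2 : z (m₁ + 1 + (i : ℤ)) = z (m₁ + (i : ℤ) + 1) := congr_arg z (by ring)
    rw [e1, e2]
  rw [hQ]
  set Q : ℝ := ∑ i ∈ Finset.range n, ((z (m₁ + (i : ℤ) + 1) - z (m₁ + (i : ℤ))) -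
    (z (m₁ + 1 + (i : ℤ) + 1) - z (m₁ + 1 + (i : ℤ)))) ^ 2 with hQdef
  -- the energy inequality, multiplied out (`K = n + 1`)
  have ht2 : (0 : ℝ) < ((n + 1 : ℕ) : ℝ) ^ 2 := by positivity
  have key : ((n + 1 : ℕ) : ℝ) ^ 2 * (2 * κ * Q) ≤
      ((n + 1 : ℕ) : ℝ) ^ 2 * ((4 * |CU| + 4 * |CL| + 64) * Cc) := by
    have m1 := mul_le_mul_of_nonneg_left hB1.1 ht2.le
    have m2 := mul_le_mul_of_nonneg_left hB2.1 ht2.le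
    have m3 := mul_le_mul_of_nonneg_left hBh.2 ht2.le
    have m4 := mul_le_mul_of_nonneg_left hcv ht2.le
    nlinarith [m1, m2, m3, m4, hU1', hU2', hLh', abs_nonneg CU, abs_nonneg CL, hCc]
  have key' : 2 * κ * Q ≤ (4 * |CU| + 4 * |CL| + 64) * Cc := le_of_mul_le_mul_left key ht2
  rw [le_div_iff₀ (by positivity)]
  linarith

/-- **Anchor (registered sub-goal form of `hull_sqVariation_le_of_landed`, same statement).** Every
layered hull element of a Lennard-Jones ground-state sequence has squared increment variation at most
`O₀` on every block of layers whose interior layers are hexagonal — the block-local Part B of the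
energetic residual of `stub_uniformSpacing`. [folklore] -/
theorem stub_hullSqVariation :
    ∃ O₀ : ℝ, ∀ (x : (N : ℕ) → (Fin N → (EuclideanSpace ℝ (Fin 3)))), (∀ N, IsGroundState lennardJones (x N)) →
      ∀ (a : ℝ), 47 / 50 ≤ a → a ≤ 1 →
      ∀ (A : (EuclideanSpace ℝ (Fin 3)) →ₗᵢ[ℝ] (EuclideanSpace ℝ (Fin 3))) (s : ℤ → ℤ) (z : ℤ → ℝ),
      IsHaggSeq s → (∀ m : ℤ, 39 / 50 * a ≤ z (m + 1) - z m ∧ z (m + 1) - z m ≤ 17 / 20 * a) →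
      (let S : Set (EuclideanSpace ℝ (Fin 3)) := {p | ∃ m i j : ℤ, p = A (((i : ℝ) • triangularVec₁ a) +
          ((j : ℝ) • triangularVec₂ a) + ((haggLabel s m : ℝ) • barlowOffset a) + (z m • layerNormal 1))};
        ∀ R ε : ℝ, 0 < ε → ∃ᶠ N in atTop, ∃ t : (EuclideanSpace ℝ (Fin 3)),
          (∀ p ∈ S, ‖p‖ ≤ R → ∃ i : Fin N, dist (x N i + t) p ≤ ε) ∧
          (∀ i : Fin N, ‖x N i + t‖ ≤ R → ∃ p ∈ S, dist (x N i + t) p ≤ ε)) →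
      ∀ (m₁ : ℤ) (n : ℕ), (∀ l : ℕ, l < n → s (m₁ + l + 1) = -s (m₁ + l)) →
        ∑ i ∈ Finset.range n,
          ((z (m₁ + i + 1) - z (m₁ + i)) - (z (m₁ + i + 2) - z (m₁ + i + 1))) ^ 2 ≤ O₀ :=
  hull_sqVariation_le_of_landed

end Summit.AtomisticToContinuum.Crystallization.Theorems.SquareWellLayerCakeGapTwelveToBarlow

end
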